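import Summits.BirchSwinnertonDyer.BirchSwinnertonDyer.Theorems.InertBadSignedBranchesInertBadAtThreeIstarZeroPeriodRatioOfMazur
import HarnessLib

/-!
# Route `InertBadSignedBranches` (rung K8): the odd-`p` nodes of the signed type `(p, I₀*)` — class
# level `LowerHalfOnType p I₀*` and the typed missing input — WITHOUT the displayed period datum
# (`hper` from Mazur's `p ∤ c₀` at every odd `p`; sequel of `…IstarZeroPeriodRatioOfMazur.lean`;
# helper toward stmt-BirchSwinnertonDyer-19656; cell `b2b-bsdres`, seat x1b GEN 46, file 132; theorems only)

HONEST FRAMING (cell `b2b-bsdres`, run/shared/lean/b2b/bsd-rank1-residual/, verbatim in every file):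
the goal of the cell is to DELETE the COMBINATION-SHAPED residual classes of the Birch–Swinnerton-Dyer
formula for ALL analytic-rank `≤ 1` elliptic curves over `ℚ` — "full BSD formula for every rank `≤ 1`
curve in class `C`" assembled STRICTLY from published theorems — so that the rank-`≤ 1` remainder
becomes exactly the CONSTRUCTION-SHAPED classes, which are TYPED (missing-input `Prop`s), NOT
attempted. This is not "finishing BSD". Research route; NO CLAIM BEYOND STATED CLASSES; the class
served (O10-PS = X12 ∩ CM-inert ∩ Kodaira `I₀*`, at any odd `p`) stays CONSTRUCTION-SHAPED and OPEN;
nothing here changes a label or a mark. THEOREMS ONLY (0 definitions, 0 named facts minted, 0 `sorry`):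
every conclusion is CONDITIONAL on its displayed hypotheses — the law in pair form / (GZ_η-VAL), (C1_η)
and the readings appear ONLY as hypotheses; the named fact `mazur_not_dvd_maninConstant_of_odd` (Mazur
1978 Cor. 4.1 in lattice form; PRINTED PROOF, not formalised) is TAKEN AS A HYPOTHESIS `hM`
(conditional result), never asserted.

PARTITION (D-0054): CornerF inert-bad sub-cell (B12 / O10; O10-PS `e = 2`) × ALL rank-one pairs of
signed local type `(p, I₀*)` × every odd `p` — types-the-object-of / none: removes the displayed
period-ratio binder `hper` of the seat bsd-cm-inert's odd-`p` nodes
(`InertBadOdd.lowerHalfOnType_IstarZero_of_pairLaw_of_lowerReading_of_ne_two`,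
`InertBadOdd.missingInputAt_IstarZero_of_pairLaw_of_readings_of_ne_two`,
`InertBadOdd.missingInputAt_IstarZero_of_etaGZValuation_of_readings_of_ne_two`) modulo ONE EXISTING
named fact which is already a conjunct of the route's `PublishedFactsInert`; closes no cell, books
nothing, moves no mark.

## What is here (§1 = `periodRatio_of_mazur_of_ne_two` of the prequel)

* `lowerHalfOnType_IstarZero_of_pairLaw_of_lowerReading_of_mazur_of_ne_two` — the O10-PS CLASS NODE
  at any odd `p` (`LowerHalfOnType p I₀*`) ⟸ law in pair form ∧ (C1_η) ∧ hmod / hGZ / hGZK / hPT / hnf /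
  hM ∧ lower Kobayashi-7.4 reading ∧ `ord_p c_p = 0` on the type — NO period datum;
* `missingInputAt_IstarZero_of_pairLaw_of_readings_of_mazur_of_ne_two` — the typed missing input on the
  type at any odd `p`, same inputs with the exact reading + (R2);
* `missingInputAt_IstarZero_of_etaGZValuation_of_readings_of_mazur_of_ne_two` — the same from
  (GZ_η-VAL) in print currency.
NET (nothing booked; no mark / label / tier / count moves): at every odd `p` the O10-PS nodes display
exactly the `p ≥ 5` input list of the route's bridge (`PublishedFactsInert` = hmod ∧ hGZ ∧ hGZK ∧ hPT ∧
hnf ∧ hM) plus `ord_p c_p(W) = 0` (automatic at `p ≥ 5`, Kodaira–Néron; at `p = 3` the CM Tamagawa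
lemma of the prequel's `p = 3` instances).

References (locators only): [Mazur1978] Cor. 4.1; [GreenbergVatsal2000] §3 Rem. 3.4; [Serre1972]
§1.11 Prop. 12; [Kobayashi2003] Thm. 3.2 (p. 7), §4 (p. 8), Thm. 7.4 (p. 13); [Miller2011LMS] §1,
Def. 1.1; [SilvermanAEC2009] IV.6.4, VII.6.3.
-/

set_option autoImplicit false
set_option linter.dupNamespace false

noncomputable section

open scoped Classical MatrixGroups ModularForm NumberField

open CongruenceSubgroup Field NumberField IsDedekindDomain IsDedekindDomain.HeightOneSpectrum
  WeierstrassCurve Rat.HeightOneSpectrum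
open Literature.NumberTheory.EllipticCurves
open Literature.NumberTheory.EllipticCurves.ModularForms
open Literature.NumberTheory.EllipticCurves.Kobayashi2003 hiding IsQuadraticBranchMinusLFunction
open Literature.NumberTheory.EllipticCurves.Rank1Residual
open Literature.NumberTheory.EllipticCurves.Rank1Residual.Typed
open Literature.NumberTheory.GaloisRepresentations
open Literature.NumberTheory.GaloisCohomology
open Summit.BirchSwinnertonDyer.Rank1Residual
open Summit.BirchSwinnertonDyer.Rank1Residual.Additive
open Summit.BirchSwinnertonDyer.Rank1Residual.Additive.LocalLog
open Summit.BirchSwinnertonDyer.Rank1Residual.X12.O10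
open Summit.BirchSwinnertonDyer.BirchSwinnertonDyer.Theorems.EtaGZ

namespace Summit.BirchSwinnertonDyer.BirchSwinnertonDyer.Theorems.InertBadOdd

/-! ## The odd-`p` nodes of the seat bsd-cm-inert with `hper` DISCHARGED by Mazur's `p ∤ c₀` -/

section OddPrime

variable (p : ℕ) [hp : Fact p.Prime]

/-- **THE O10-PS CLASS NODE AT ANY ODD `p`, `LowerHalfOnType p I₀*`, with NO period datum**:
`InertBadOdd.lowerHalfOnType_IstarZero_of_pairLaw_of_lowerReading_of_ne_two` with its displayed
`hper` DISCHARGED by `periodRatio_of_mazur_of_ne_two`. Inputs: the law in pair form on the type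
(`hlaw`), (C1_η) on the CM good-inert curves (`hC1`), named facts hmod / hGZ / hGZK / hPT / hnf / hM,
the LOWER Kobayashi-7.4 reading on the type (`h74l`), `ord_p c_p(W) = 0` on the type (`hcp`).
CONDITIONAL on every displayed hypothesis; nothing booked; O10 stays OPEN at class level.
[cite: Mazur1978, Cor. 4.1] [cite: Kobayashi2003, §4 (p. 8), Thm. 7.4 (p. 13), Thm. 3.2 (p. 7)]
[cite: Miller2011LMS, Def. 1.1] -/
theorem lowerHalfOnType_IstarZero_of_pairLaw_of_lowerReading_of_mazur_of_ne_two
    (hmod : hasEntireLFunction_rat) (hGZ : GrossZagier1986_thm_I_7_3)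
    (hGZK : rank_eq_analyticRank_of_analyticRank_le_one)
    (hPT : poitouTate_selmerStructure_duality_real ℚ) (hnf : exists_isNewformOf)
    (hM : mazur_not_dvd_maninConstant_of_odd)
    (hlaw : ∀ (W : WeierstrassCurve ℚ) [W.IsElliptic] [W.IsGloballyMinimal],
      HasSignedLocalType W p (.Istar 0) → W.analyticRank = 1 →
      ∀ (V : WeierstrassCurve ℚ) [V.IsElliptic] [V.IsGloballyMinimal] (C : VariableChange ℚ)
        {N : ℕ} [NeZero N] {f : CuspForm (Gamma0 N) 2},
        C • W.quadraticTwist ((-1) ^ (p / 2) * p) = V →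
        V.HasGoodReductionAtPrime p → V.frobeniusTrace p = 0 → IsNewformOf V f →
        ∀ (ϖ : ℚ), (if Even (p / 2) then (ϖ : ℝ) * V.realPeriodRat = plusPeriod f
            else (ϖ : ℝ) * V.imaginaryPeriodRat = minusPeriod f) →
        ∀ (L : IwasawaAlgebra p), IsQuadraticBranchMinusLFunction f p ϖ L →
        (∀ Q : (W.baseChange ℚ_[p]).toAffine.Point, p • Q = 0 → Q = 0) →
        ∀ (P : W.toAffine.Point) (n : ℕ), ¬ IsOfFinAddOrder P →
        (∀ R : W.toAffine.Point, ∃ (k : ℤ) (T : W.toAffine.Point), IsOfFinAddOrder T ∧ R = k • P + T) →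
        (∃ Q : (W.baseChange ℚ_[p]).toAffine.Point, p ^ n • Q = W.toPadicPoint p P) →
        (∀ Q : (W.baseChange ℚ_[p]).toAffine.Point, p ^ (n + 1) • Q ≠ W.toPadicPoint p P) →
        ∀ (q : ℚ), shaAn W = (q : ℂ) →
        PowerSeries.coeff 1 L ≠ 0 ∧
          ((PowerSeries.coeff 1 L : ℤ_[p]) : ℚ_[p]).valuation =
            2 * (n : ℤ) + padicValRat p (q * W.tamagawaProduct / (W.torsionOrder : ℚ) ^ 2))
    (h74l : ∀ (W : WeierstrassCurve ℚ) [W.IsElliptic] [W.IsGloballyMinimal],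
      HasSignedLocalType W p (.Istar 0) → W.analyticRank = 1 →
      ∀ (V : WeierstrassCurve ℚ) [V.IsElliptic] [V.IsGloballyMinimal] (C : VariableChange ℚ)
        {N : ℕ} [NeZero N] {f : CuspForm (Gamma0 N) 2},
        p ≠ 2 → C • W.quadraticTwist ((-1) ^ (p / 2) * p) = V →
        V.HasGoodReductionAtPrime p → V.frobeniusTrace p = 0 →
        QuadraticBranchPlusMainConjectureAt V p → IsNewformOf V f →
        ∀ (ϖ : ℚ), (if Even (p / 2) then (ϖ : ℝ) * V.realPeriodRat = plusPeriod f
            else (ϖ : ℝ) * V.imaginaryPeriodRat = minusPeriod f) →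
        ∀ (Lη : IwasawaAlgebra p), IsQuadraticBranchMinusLFunction f p ϖ Lη →
        ∀ (κ : ZpExtension ℚ p) (γ : Field.absoluteGaloisGroup ℚ),
          κ.IsCyclotomic → κ.IsTopGenerator γ → IsCyclotomicVariable p γ →
        ∀ (D : StrictSignedSelmerDualData W κ ℚ_[p] γ (-1)) (L' : IwasawaAlgebra p),
          Lη = PowerSeries.X * L' → D.charIdeal ≤ Ideal.span {L'})
    (hC1 : ∀ (V : WeierstrassCurve ℚ) [V.IsElliptic] [V.IsGloballyMinimal], V.HasCM →
      V.HasGoodReductionAtPrime p → CMInert V p → QuadraticBranchPlusMainConjectureAt V p)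
    (hcp : ∀ (W : WeierstrassCurve ℚ) [W.IsElliptic] [W.IsGloballyMinimal],
      HasSignedLocalType W p (.Istar 0) →
      padicValNat p ((W.baseChange (((primesEquiv (R := 𝓞 ℚ)).symm ⟨p, hp.out⟩).adicCompletion ℚ)).localTamagawaNumber
        (((primesEquiv (R := 𝓞 ℚ)).symm ⟨p, hp.out⟩).adicCompletionIntegers ℚ)) = 0)
    (hp2 : p ≠ 2) : LowerHalfOnType p (.Istar 0) :=
  lowerHalfOnType_IstarZero_of_pairLaw_of_lowerReading_of_ne_two (p := p) hmod hGZ hGZK hPT hnf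
    (periodRatio_of_mazur_of_ne_two p hM hp2) hlaw h74l hC1 hcp hp2

/-- **THE TYPED MISSING INPUT ON THE SIGNED TYPE `(p, I₀*)` AT ANY ODD `p`, with NO period datum**:
`InertBadOdd.missingInputAt_IstarZero_of_pairLaw_of_readings_of_ne_two` with its displayed `hper`
DISCHARGED by `periodRatio_of_mazur_of_ne_two`. Inputs: the law in pair form on the type (`hlaw`),
(C1_η) (`hC1`), named facts hmod / hGZ / hGZK / hPT / hnf / hM, the readings on the type ((R2) typed,
`h74x` exact: `hRd`), `ord_p c_p = 0` on the type (`hcp`). CONDITIONAL; nothing booked.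
[cite: Mazur1978, Cor. 4.1] [cite: Kobayashi2003, §4 (p. 8), Thm. 7.4 (p. 13)]
[cite: KitajimaOtsuki2018, Main Thm. 1.3 (arXiv:1607.03612 p. 3)] [cite: Miller2011LMS, §1 and Def. 1.1] -/
theorem missingInputAt_IstarZero_of_pairLaw_of_readings_of_mazur_of_ne_two
    (hmod : hasEntireLFunction_rat) (hGZ : GrossZagier1986_thm_I_7_3)
    (hGZK : rank_eq_analyticRank_of_analyticRank_le_one)
    (hPT : poitouTate_selmerStructure_duality_real ℚ) (hnf : exists_isNewformOf)
    (hM : mazur_not_dvd_maninConstant_of_odd)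
    (hlaw : ∀ (W : WeierstrassCurve ℚ) [W.IsElliptic] [W.IsGloballyMinimal],
      HasSignedLocalType W p (.Istar 0) → W.analyticRank = 1 →
      ∀ (V : WeierstrassCurve ℚ) [V.IsElliptic] [V.IsGloballyMinimal] (C : VariableChange ℚ)
        {N : ℕ} [NeZero N] {f : CuspForm (Gamma0 N) 2},
        C • W.quadraticTwist ((-1) ^ (p / 2) * p) = V →
        V.HasGoodReductionAtPrime p → V.frobeniusTrace p = 0 → IsNewformOf V f →
        ∀ (ϖ : ℚ), (if Even (p / 2) then (ϖ : ℝ) * V.realPeriodRat = plusPeriod f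
            else (ϖ : ℝ) * V.imaginaryPeriodRat = minusPeriod f) →
        ∀ (L : IwasawaAlgebra p), IsQuadraticBranchMinusLFunction f p ϖ L →
        (∀ Q : (W.baseChange ℚ_[p]).toAffine.Point, p • Q = 0 → Q = 0) →
        ∀ (P : W.toAffine.Point) (n : ℕ), ¬ IsOfFinAddOrder P →
        (∀ R : W.toAffine.Point, ∃ (k : ℤ) (T : W.toAffine.Point), IsOfFinAddOrder T ∧ R = k • P + T) →
        (∃ Q : (W.baseChange ℚ_[p]).toAffine.Point, p ^ n • Q = W.toPadicPoint p P) →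
        (∀ Q : (W.baseChange ℚ_[p]).toAffine.Point, p ^ (n + 1) • Q ≠ W.toPadicPoint p P) →
        ∀ (q : ℚ), shaAn W = (q : ℂ) →
        PowerSeries.coeff 1 L ≠ 0 ∧
          ((PowerSeries.coeff 1 L : ℤ_[p]) : ℚ_[p]).valuation =
            2 * (n : ℤ) + padicValRat p (q * W.tamagawaProduct / (W.torsionOrder : ℚ) ^ 2))
    (hRd : ∀ (W : WeierstrassCurve ℚ) [W.IsElliptic] [W.IsGloballyMinimal],
      HasSignedLocalType W p (.Istar 0) → W.analyticRank = 1 →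
      OddBranchStrictMinusNoFiniteSubmoduleAt W p ∧
      ∀ (V : WeierstrassCurve ℚ) [V.IsElliptic] [V.IsGloballyMinimal] (C : VariableChange ℚ)
        {N : ℕ} [NeZero N] {f : CuspForm (Gamma0 N) 2},
        p ≠ 2 → C • W.quadraticTwist ((-1) ^ (p / 2) * p) = V →
        V.HasGoodReductionAtPrime p → V.frobeniusTrace p = 0 →
        QuadraticBranchPlusMainConjectureAt V p → IsNewformOf V f →
        ∀ (ϖ : ℚ), (if Even (p / 2) then (ϖ : ℝ) * V.realPeriodRat = plusPeriod f
            else (ϖ : ℝ) * V.imaginaryPeriodRat = minusPeriod f) →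
        ∀ (Lη : IwasawaAlgebra p), IsQuadraticBranchMinusLFunction f p ϖ Lη →
        ∀ (κ : ZpExtension ℚ p) (γ : Field.absoluteGaloisGroup ℚ),
          κ.IsCyclotomic → κ.IsTopGenerator γ → IsCyclotomicVariable p γ →
        ∀ (D : StrictSignedSelmerDualData W κ ℚ_[p] γ (-1)) (L' : IwasawaAlgebra p),
          Lη = PowerSeries.X * L' → D.charIdeal = Ideal.span {L'})
    (hC1 : ∀ (V : WeierstrassCurve ℚ) [V.IsElliptic] [V.IsGloballyMinimal], V.HasCM →
      V.HasGoodReductionAtPrime p → CMInert V p → QuadraticBranchPlusMainConjectureAt V p)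
    (hcp : ∀ (W : WeierstrassCurve ℚ) [W.IsElliptic] [W.IsGloballyMinimal],
      HasSignedLocalType W p (.Istar 0) →
      padicValNat p ((W.baseChange (((primesEquiv (R := 𝓞 ℚ)).symm ⟨p, hp.out⟩).adicCompletion ℚ)).localTamagawaNumber
        (((primesEquiv (R := 𝓞 ℚ)).symm ⟨p, hp.out⟩).adicCompletionIntegers ℚ)) = 0)
    (hp2 : p ≠ 2) :
    ∀ (W : WeierstrassCurve ℚ) [W.IsElliptic] [W.IsGloballyMinimal],
      HasSignedLocalType W p (.Istar 0) → W.analyticRank = 1 → X12.MissingInputAt W p :=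
  missingInputAt_IstarZero_of_pairLaw_of_readings_of_ne_two (p := p) hmod hGZ hGZK hPT hnf
    (periodRatio_of_mazur_of_ne_two p hM hp2) hlaw hRd hC1 hcp hp2

/-- **THE TYPED MISSING INPUT ON `(p, I₀*)` AT ANY ODD `p` FROM (GZ_η-VAL) IN PRINT CURRENCY, with NO
period datum**: `InertBadOdd.missingInputAt_IstarZero_of_etaGZValuation_of_readings_of_ne_two` with its
displayed `hper` DISCHARGED by `periodRatio_of_mazur_of_ne_two`. Inputs: (GZ_η-VAL) on the type
(`hGZ`), (C1_η) (`hC1`), named facts hmod / hGZ / hGZK / hPT / hnf / hM, the readings (`hRd`),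
`ord_p c_p = 0` on the type (`hcp`). CONDITIONAL; nothing booked. [cite: Mazur1978, Cor. 4.1]
[cite: Kobayashi2003, §4 (p. 8), Thm. 7.4 (p. 13)] [cite: Miller2011LMS, §1 and Def. 1.1]
[cite: SilvermanAEC2009, IV.6.4 and VII.6.3] -/
theorem missingInputAt_IstarZero_of_etaGZValuation_of_readings_of_mazur_of_ne_two
    (hmod : hasEntireLFunction_rat) (hGZfact : GrossZagier1986_thm_I_7_3)
    (hGZK : rank_eq_analyticRank_of_analyticRank_le_one)
    (hPT : poitouTate_selmerStructure_duality_real ℚ) (hnf : exists_isNewformOf)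
    (hM : mazur_not_dvd_maninConstant_of_odd)
    (hGZ : ∀ (W : WeierstrassCurve ℚ) [W.IsElliptic] [W.IsGloballyMinimal],
      HasSignedLocalType W p (.Istar 0) → W.analyticRank = 1 →
      ∀ (V : WeierstrassCurve ℚ) [V.IsElliptic] [V.IsGloballyMinimal] (C : VariableChange ℚ)
        {N : ℕ} [NeZero N] {f : CuspForm (Gamma0 N) 2},
        C • W.quadraticTwist ((-1) ^ (p / 2) * p) = V →
        V.HasGoodReductionAtPrime p → V.frobeniusTrace p = 0 → IsNewformOf V f →
        ∀ (ϖ : ℚ), (if Even (p / 2) then (ϖ : ℝ) * V.realPeriodRat = plusPeriod f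
            else (ϖ : ℝ) * V.imaginaryPeriodRat = minusPeriod f) →
        ∀ (L : IwasawaAlgebra p), IsQuadraticBranchMinusLFunction f p ϖ L →
        ∀ (P : W.toAffine.Point), ¬ IsOfFinAddOrder P →
        (∀ R : W.toAffine.Point, ∃ (k : ℤ) (T : W.toAffine.Point), IsOfFinAddOrder T ∧ R = k • P + T) →
        ∀ (q : ℚ), W.leadingLCoeff / ((W.realPeriodRat * W.regulator : ℝ) : ℂ) = (q : ℂ) →
        PowerSeries.coeff 1 L ≠ 0 ∧
          ((PowerSeries.coeff 1 L : ℤ_[p]) : ℚ_[p]).valuation =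
            2 * (padicLog (W.baseChange ℚ_[p]) (W.toPadicPoint p P)).valuation + padicValRat p q)
    (hRd : ∀ (W : WeierstrassCurve ℚ) [W.IsElliptic] [W.IsGloballyMinimal],
      HasSignedLocalType W p (.Istar 0) → W.analyticRank = 1 →
      OddBranchStrictMinusNoFiniteSubmoduleAt W p ∧
      ∀ (V : WeierstrassCurve ℚ) [V.IsElliptic] [V.IsGloballyMinimal] (C : VariableChange ℚ)
        {N : ℕ} [NeZero N] {f : CuspForm (Gamma0 N) 2},
        p ≠ 2 → C • W.quadraticTwist ((-1) ^ (p / 2) * p) = V →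
        V.HasGoodReductionAtPrime p → V.frobeniusTrace p = 0 →
        QuadraticBranchPlusMainConjectureAt V p → IsNewformOf V f →
        ∀ (ϖ : ℚ), (if Even (p / 2) then (ϖ : ℝ) * V.realPeriodRat = plusPeriod f
            else (ϖ : ℝ) * V.imaginaryPeriodRat = minusPeriod f) →
        ∀ (Lη : IwasawaAlgebra p), IsQuadraticBranchMinusLFunction f p ϖ Lη →
        ∀ (κ : ZpExtension ℚ p) (γ : Field.absoluteGaloisGroup ℚ),
          κ.IsCyclotomic → κ.IsTopGenerator γ → IsCyclotomicVariable p γ →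
        ∀ (D : StrictSignedSelmerDualData W κ ℚ_[p] γ (-1)) (L' : IwasawaAlgebra p),
          Lη = PowerSeries.X * L' → D.charIdeal = Ideal.span {L'})
    (hC1 : ∀ (V : WeierstrassCurve ℚ) [V.IsElliptic] [V.IsGloballyMinimal], V.HasCM →
      V.HasGoodReductionAtPrime p → CMInert V p → QuadraticBranchPlusMainConjectureAt V p)
    (hcp : ∀ (W : WeierstrassCurve ℚ) [W.IsElliptic] [W.IsGloballyMinimal],
      HasSignedLocalType W p (.Istar 0) →
      padicValNat p ((W.baseChange (((primesEquiv (R := 𝓞 ℚ)).symm ⟨p, hp.out⟩).adicCompletion ℚ)).localTamagawaNumber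
        (((primesEquiv (R := 𝓞 ℚ)).symm ⟨p, hp.out⟩).adicCompletionIntegers ℚ)) = 0)
    (hp2 : p ≠ 2) :
    ∀ (W : WeierstrassCurve ℚ) [W.IsElliptic] [W.IsGloballyMinimal],
      HasSignedLocalType W p (.Istar 0) → W.analyticRank = 1 → X12.MissingInputAt W p :=
  missingInputAt_IstarZero_of_etaGZValuation_of_readings_of_ne_two p hmod hGZfact hGZK hPT hnf
    (periodRatio_of_mazur_of_ne_two p hM hp2) hGZ hRd hC1 hcp hp2

end OddPrime

end Summit.BirchSwinnertonDyer.BirchSwinnertonDyer.Theorems.InertBadOdd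

end
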